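import Literature.Computability.Complexity.SparseHardSets
import Literature.Computability.Complexity.OnesZeroPadding
import Literature.Computability.Complexity.CodeFPBudgets
import Literature.Computability.Complexity.CodeFPArith
import Literature.Computability.Complexity.CountingHierarchyProofs
import Literature.Computability.Complexity.NondeterministicProofs
import Literature.Computability.Complexity.CountingHierarchyInter
import HarnessLib

/-!
# No `NP`-hard set is P-selective unless `P = NP` (Selman 1979)

Reproduction (statement **and complete proof**, over the tree's `TM2` model: `Classes.P`,
`Nondeterministic.NP`, `FP`, Karp hardness `IsHard`) of

* A. L. Selman, *P-selective sets, tally languages, and the behavior of polynomial time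
  reducibilities on NP*, Math. Systems Theory **13** (1979) 55–65 — the theorem that an
  `NP`-complete P-selective set forces `P = NP`;
* as presented in L. A. Hemaspaandra, L. Torenvliet, *Theory of Semi-Feasible Algorithms*
  (Springer, 2003), **Thm. 1.5(2)** (P-selectivity pulls back along `≤ᵖₘ`), **Thm. 1.6** (Selman's
  theorem, proved by following one branch of the disjunctive self-reduction tree of `SAT` with the
  selector) and **Thm. 4.1** ("`P = NP` if and only if there is an `NP`-`≤ᵖₘ`-hard P-selective set")
  [held: `book:hemaspaandra2003-theory-semi-feasible-algorithms`, chunks p0038 (Thm. 1.5 and proof),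
  p0039 (Thm. 1.6 and proof, Cor. 1.7), p0099 (Thm. 4.1)].

A set `T` is **P-selective** (semi-feasible) if some `s ∈ FP` satisfies `s ⟨a, b⟩ ∈ {a, b}` and
`(a ∈ T ∨ b ∈ T) → s ⟨a, b⟩ ∈ T`. To keep the file definition-free the selector is written out as
this hypothesis on `s` (pairs coded by `boolPair`).

* `exists_selector_of_mem_P` — every `L ∈ P` is P-selective.
* `NP_subset_P_of_isHard_of_selector` — **Selman's theorem**, `≤ᵖₘ`-hardness form: an `NP`-hard
  P-selective `T` gives `NP ⊆ P`. Proof (self-contained, for an arbitrary `L ∈ NP` instead of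
  `SAT`): with verifier `R ∈ P`, bound `p` and exact-length witnesses `1ʲ0y` (`|·| = p(|x|) + 1`,
  as in `SparseHardSets.lean`), the **witness-prefix language**
  `K = {⟨x, z⟩ | some accepted exact-length witness of x extends z}` is in `NP`, hence `K ≤ᵖₘ T`
  by a reduction `r`; the pulled-back selector `s_K(a, b) = (if s ⟨r a, r b⟩ = r a then a else b)`
  selects for `K`; starting from `z = ε` and replacing `z` by the selected one of `z1`, `z0` for
  `p(|x|) + 1` rounds stays inside `K` whenever `x ∈ L` (disjunctive self-reducibility of `K`), so
  `x ∈ L` iff the final `z` is an accepted witness — a polynomial-time test.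
* `singleton_nil_mem_P`, `exists_isHard_selector_iff` — Hemaspaandra–Torenvliet Thm. 4.1: an
  `NP`-hard P-selective set exists iff `NP ⊆ P` (for `⇐`, the hard set `{ε}` of
  `isHard_singleton_nil_of_NP_subset_P`, which lies in `P`).

All functions are assembled from `CodeFP` bricks (`foldl` with an explicit output budget for the
branch-following loop); no Turing machine is written.
-/

namespace Literature.Computability.Complexity

open _root_.Computability Polynomial CodeFP
open scoped Notation

/-- **Every set in `P` is P-selective**: `s ⟨a, b⟩ = a` if `a ∈ L`, else `b`.
[cite: HemaspaandraTorenvliet2003, Thm. 1.5 (proof, part 1; held book:hemaspaandra2003-theory-semi-feasible-algorithms chunk p0038)]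
[cite: Selman1979, §2 (P-selective sets; theorem number not verified: source not held)] -/
theorem exists_selector_of_mem_P {L : Language Bool} (hL : L ∈ Classes.P) :
    ∃ s ∈ FP, ∀ a b : List Bool, (s (boolPair a b) = a ∨ s (boolPair a b) = b) ∧
      ((a ∈ L ∨ b ∈ L) → s (boolPair a b) ∈ L) := by
  classical
  have h1 : CodeFP strE strE (fun z => (boolUnpair z).1) := ⟨_, boolUnpairFst_mem_FP, fun _ => rfl⟩
  have h2 : CodeFP strE strE (fun z => (boolUnpair z).2) := ⟨_, boolUnpairSnd_mem_FP, fun _ => rfl⟩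
  have hLC : CodeFP strE bitE (fun z => L.boolIndicator z) :=
    ⟨fun z => encodeBool (L.boolIndicator z), indicatorFn_mem_FP hL, fun _ => rfl⟩
  have hsC : CodeFP strE strE
      (fun z => if L.boolIndicator (boolUnpair z).1 then (boolUnpair z).1 else (boolUnpair z).2) :=
    CodeFP.ite (hLC.comp h1) h1 h2
  obtain ⟨s, hs, hsdef⟩ := hsC
  have hs' : s ∈ FP := by
    have : s = fun z => if L.boolIndicator (boolUnpair z).1 then (boolUnpair z).1
        else (boolUnpair z).2 := funext fun z => hsdef z
    exact this ▸ hs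
  refine ⟨s, hs', fun a b => ?_⟩
  have hsab : s (boolPair a b) = if L.boolIndicator a then a else b := by
    have := hsdef (boolPair a b)
    simp only [boolUnpair_boolPair] at this
    exact this
  rw [hsab]
  by_cases ha : a ∈ L
  · rw [if_pos ((Set.mem_iff_boolIndicator _ _).1 ha)]
    exact ⟨Or.inl rfl, fun _ => ha⟩
  · have hfa : ¬ (L.boolIndicator a = true) := fun h => ha ((Set.mem_iff_boolIndicator _ _).2 h)
    rw [if_neg hfa]
    exact ⟨Or.inr rfl, fun h => h.resolve_left ha⟩

/-- **Selman's theorem.** If `T` is `NP`-hard under Karp reductions and P-selective, then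
`NP ⊆ P` (follow one branch of the witness-prefix tree with the pulled-back selector).
[cite: Selman1979, main theorem (NP-complete P-selective ⇒ P = NP; theorem number not verified: source not held)]
[cite: HemaspaandraTorenvliet2003, Thm. 1.6 and Thm. 4.1 (held book:hemaspaandra2003-theory-semi-feasible-algorithms chunks p0039, p0099)] -/
theorem NP_subset_P_of_isHard_of_selector {T : Language Bool} (hT : IsHard Nondeterministic.NP T)
    (hsel : ∃ s ∈ FP, ∀ a b : List Bool, (s (boolPair a b) = a ∨ s (boolPair a b) = b) ∧
      ((a ∈ T ∨ b ∈ T) → s (boolPair a b) ∈ T)) :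
    Nondeterministic.NP ⊆ Classes.P := by
  classical
  obtain ⟨s, hs, hsel⟩ := hsel
  intro L hL
  obtain ⟨R, hR, p, hver⟩ := hL
  have hpolyU : ∀ P : Polynomial ℕ, CodeFP unE unE (fun n => P.eval n) := fun P =>
    ⟨Plumb.polyFn P, Plumb.polyFn_mem_FP P, fun n => by
      rw [Plumb.polyFn_apply, length_unE, unE_eq_ones]⟩
  /- Step 0: witnesses of the exact length `p(|x|) + 1`, front-padded as `1ʲ 0 y`. -/
  obtain ⟨RE, hRE⟩ : ∃ RE : List Bool → List Bool → Bool, RE = fun x y' =>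
      (decide (y'.length = p.eval x.length + 1) &&
        R.boolIndicator (boolPair x ((MWProtocol.stripOnes y').drop 1))) := ⟨_, rfl⟩
  have hRE1 : ∀ x y', RE x y' = true → x ∈ L := by
    intro x y' h
    rw [hRE] at h
    simp only [Bool.and_eq_true, decide_eq_true_eq] at h
    refine (hver x).2 ⟨_, ?_, (Set.mem_iff_boolIndicator _ _).2 h.2⟩
    rcases MWProtocol.eq_replicate_or_exists y' with ⟨hz, hs⟩ | ⟨a, x', hz, hs⟩
    · rw [hs]; simp
    · rw [hs]
      have := congrArg List.length hz
      simp only [List.length_append, List.length_replicate, List.length_cons] at this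
      simp only [List.drop_succ_cons, List.drop_zero]
      omega
  have hRElen : ∀ x y', RE x y' = true → y'.length = p.eval x.length + 1 := by
    intro x y' h
    rw [hRE] at h
    simp only [Bool.and_eq_true, decide_eq_true_eq] at h
    exact h.1
  have hRE2 : ∀ x ∈ L, ∃ y', y'.length = p.eval x.length + 1 ∧ RE x y' = true := by
    intro x hx
    obtain ⟨y, hy, hyR⟩ := (hver x).1 hx
    refine ⟨OnesZeroPad.padTo (p.eval x.length + 1) y, OnesZeroPad.length_padTo (by omega), ?_⟩
    rw [hRE]
    simp only [Bool.and_eq_true, decide_eq_true_eq]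
    refine ⟨OnesZeroPad.length_padTo (by omega), ?_⟩
    rw [OnesZeroPad.padTo, MWProtocol.stripOnes_replicate_append, List.drop_succ_cons, List.drop_zero]
    exact (Set.mem_iff_boolIndicator _ _).1 hyR
  have hREC : CodeFP (pairE strE strE) bitE (fun t => RE t.1 t.2) := by
    have hpay : CodeFP strE strE (fun z => (MWProtocol.stripOnes z).drop 1) :=
      CodeFP.of_fn _ OnesZeroPad.payload_mem_FP fun _ => rfl
    have hRC : CodeFP strE bitE (fun z => R.boolIndicator z) :=
      ⟨fun z => encodeBool (R.boolIndicator z), indicatorFn_mem_FP hR, fun _ => rfl⟩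
    have hm : CodeFP (pairE strE strE) unE (fun t => p.eval t.1.length + 1) :=
      (unSucc.comp ((hpolyU p).comp (strLength.comp (CodeFP.fst _ _))) :)
    have hlen : CodeFP (pairE strE strE) bitE (fun t => decide (t.2.length = p.eval t.1.length + 1)) :=
      ((CodeFP.eq unE_injective).comp ((strLength.comp (CodeFP.snd _ _)).pair hm) :)
    have hXB : CodeFP (pairE strE strE) strE
        (fun t => boolPair t.1 ((MWProtocol.stripOnes t.2).drop 1)) :=
      ((CodeFP.fst _ _).pair (hpay.comp (CodeFP.snd _ _))).recodeOut fun _ => rfl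
    rw [hRE]
    exact hlen.and (hRC.comp hXB)
  have h1 : CodeFP strE strE (fun z => (boolUnpair z).1) := ⟨_, boolUnpairFst_mem_FP, fun _ => rfl⟩
  have h2 : CodeFP strE strE (fun z => (boolUnpair z).2) := ⟨_, boolUnpairSnd_mem_FP, fun _ => rfl⟩
  /- Step 1: the witness-prefix language `K`, an `NP` language. -/
  obtain ⟨RK, hRK⟩ : ∃ RK : Language Bool, RK = {u | RE (boolUnpair (boolUnpair u).1).1
      ((boolUnpair (boolUnpair u).1).2 ++ (boolUnpair u).2) = true} := ⟨_, rfl⟩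
  have hRKmem : ∀ u, u ∈ RK ↔ RE (boolUnpair (boolUnpair u).1).1
      ((boolUnpair (boolUnpair u).1).2 ++ (boolUnpair u).2) = true := fun u => by
    rw [hRK]; exact Iff.rfl
  have hRKpair : ∀ x z v, boolPair (boolPair x z) v ∈ RK ↔ RE x (z ++ v) = true := by
    intro x z v
    simp only [hRKmem, boolUnpair_boolPair]
  have hRKP : RK ∈ Classes.P := by
    have htest : CodeFP strE bitE (fun u => RE (boolUnpair (boolUnpair u).1).1
        ((boolUnpair (boolUnpair u).1).2 ++ (boolUnpair u).2)) :=
      (hREC.comp ((h1.comp h1).pair (strAppend.comp ((h2.comp h1).pair h2))) :)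
    obtain ⟨d, hd, hdw⟩ := htest
    refine mem_P_of_mem_FP hd _ fun w => ⟨fun hw => ?_, fun hw => ?_⟩
    · rw [hRKmem] at hw
      have := hdw w
      beta_reduce at this
      rw [hw] at this
      exact this
    · rw [hRKmem, Bool.not_eq_true] at hw
      have := hdw w
      beta_reduce at this
      rw [hw] at this
      exact this
  obtain ⟨K, hKdef⟩ : ∃ K : Language Bool,
      K = {w | ∃ v, v.length ≤ (p + 1).eval w.length ∧ boolPair w v ∈ RK} := ⟨_, rfl⟩
  have hKmem : ∀ w, w ∈ K ↔ ∃ v, v.length ≤ (p + 1).eval w.length ∧ boolPair w v ∈ RK :=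
    fun w => by rw [hKdef]; exact Iff.rfl
  have hKNP : K ∈ Nondeterministic.NP := ⟨RK, hRKP, p + 1, hKmem⟩
  have hK : ∀ x z, boolPair x z ∈ K ↔ ∃ v, RE x (z ++ v) = true := by
    intro x z
    rw [hKmem]
    constructor
    · rintro ⟨v, -, hv⟩
      exact ⟨v, (hRKpair x z v).1 hv⟩
    · rintro ⟨v, hv⟩
      refine ⟨v, ?_, (hRKpair x z v).2 hv⟩
      have hl := hRElen x _ hv
      rw [List.length_append] at hl
      rw [eval_add, eval_one, length_boolPair]
      have := TM2Iter.eval_mono p (show x.length ≤ 2 * x.length + 2 + z.length by omega)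
      omega
  /- Step 2: `K ≤ᵖₘ T` and the pulled-back selector. -/
  obtain ⟨r, hr, hrK⟩ := hT K hKNP
  have hrC : CodeFP strE strE r := ⟨r, hr, fun _ => rfl⟩
  have hsC : CodeFP strE strE s := ⟨s, hs, fun _ => rfl⟩
  obtain ⟨selK, hselKdef⟩ : ∃ selK : List Bool → List Bool → List Bool, selK = fun a b =>
      if decide (s (boolPair (r a) (r b)) = r a) then a else b := ⟨_, rfl⟩
  have hselK_or : ∀ a b, selK a b = a ∨ selK a b = b := by
    intro a b
    rw [hselKdef]
    dsimp only
    split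
    · exact Or.inl rfl
    · exact Or.inr rfl
  have hselK : ∀ a b, (a ∈ K ∨ b ∈ K) → selK a b ∈ K := by
    intro a b hab
    rw [hselKdef]
    dsimp only
    obtain ⟨hor, hin⟩ := hsel (r a) (r b)
    split
    · rename_i hc
      have hc' : s (boolPair (r a) (r b)) = r a := of_decide_eq_true hc
      rcases hab with ha | hb
      · exact ha
      · refine (hrK a).2 ?_
        rw [← hc']
        exact hin (Or.inr ((hrK b).1 hb))
    · rename_i hc
      have hc' : s (boolPair (r a) (r b)) ≠ r a := fun h => hc (decide_eq_true h)
      have hsb : s (boolPair (r a) (r b)) = r b := hor.resolve_left hc'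
      rcases hab with ha | hb
      · refine (hrK b).2 ?_
        rw [← hsb]
        exact hin (Or.inl ((hrK a).1 ha))
      · exact hb
  have hselKC : CodeFP (pairE strE strE) strE (fun t => selK t.1 t.2) := by
    have hRR : CodeFP (pairE strE strE) strE (fun t => boolPair (r t.1) (r t.2)) :=
      ((hrC.comp (CodeFP.fst _ _)).pair (hrC.comp (CodeFP.snd _ _))).recodeOut fun _ => rfl
    have hcond : CodeFP (pairE strE strE) bitE
        (fun t => decide (s (boolPair (r t.1) (r t.2)) = r t.1)) :=
      ((CodeFP.eq (eα := strE) Function.injective_id).comp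
        ((hsC.comp hRR).pair (hrC.comp (CodeFP.fst _ _))) :)
    rw [hselKdef]
    exact (CodeFP.ite hcond (CodeFP.fst _ _) (CodeFP.snd _ _) :)
  /- Step 3: one round of branch following, `z ↦ the selected one of z1, z0`. -/
  obtain ⟨stepK, hstepK⟩ : ∃ stepK : List Bool → List Bool → List Bool, stepK = fun x z =>
      if decide (selK (boolPair x (z ++ [true])) (boolPair x (z ++ [false])) =
          boolPair x (z ++ [true])) then z ++ [true] else z ++ [false] := ⟨_, rfl⟩
  have hstep_len : ∀ x z, (stepK x z).length = z.length + 1 := by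
    intro x z
    rw [hstepK]
    dsimp only
    split <;> simp
  have hstep_mem : ∀ x z, (boolPair x (z ++ [true]) ∈ K ∨ boolPair x (z ++ [false]) ∈ K) →
      boolPair x (stepK x z) ∈ K := by
    intro x z h
    have hselmem := hselK _ _ h
    rw [hstepK]
    dsimp only
    split
    · rename_i hc
      rw [← of_decide_eq_true hc]
      exact hselmem
    · rename_i hc
      have hc' : selK (boolPair x (z ++ [true])) (boolPair x (z ++ [false])) ≠
          boolPair x (z ++ [true]) := fun h' => hc (decide_eq_true h')
      rw [← (hselK_or _ _).resolve_left hc']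
      exact hselmem
  have hfold_len : ∀ x (l : List ℕ) (z : List Bool),
      (l.foldl (fun z _ => stepK x z) z).length = z.length + l.length := by
    intro x l
    induction l with
    | nil => intro z; simp
    | cons a l ih => intro z; rw [List.foldl_cons, ih, hstep_len, List.length_cons]; omega
  obtain ⟨m, hm⟩ : ∃ m : List Bool → ℕ, m = fun x => p.eval x.length + 1 := ⟨_, rfl⟩
  have hmx : ∀ x, m x = p.eval x.length + 1 := fun x => by rw [hm]
  -- the invariant: inside `K` along the followed branch, as long as `x ∈ L`
  have hinv : ∀ x ∈ L, ∀ j, j ≤ m x →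
      boolPair x ((List.range j).foldl (fun z _ => stepK x z) []) ∈ K ∧
        ((List.range j).foldl (fun z _ => stepK x z) []).length = j := by
    intro x hx j
    induction j with
    | zero =>
      intro _
      simp only [List.range_zero, List.foldl_nil, List.length_nil, and_true]
      obtain ⟨y', -, hy'⟩ := hRE2 x hx
      exact (hK x []).2 ⟨y', by rw [List.nil_append]; exact hy'⟩
    | succ j ih =>
      intro hj
      obtain ⟨hmem, hlen⟩ := ih (by omega)
      rw [List.range_succ, List.foldl_append, List.foldl_cons, List.foldl_nil]
      generalize (List.range j).foldl (fun z _ => stepK x z) [] = z at hmem hlen ⊢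
      refine ⟨hstep_mem x z ?_, by rw [hstep_len, hlen]⟩
      obtain ⟨v, hv⟩ := (hK x z).1 hmem
      have hl := hRElen x _ hv
      rw [List.length_append, hlen, ← hmx] at hl
      rcases v with _ | ⟨c, v'⟩
      · simp only [List.length_nil] at hl
        omega
      · have hv'' : RE x ((z ++ [c]) ++ v') = true := by
          rw [List.append_assoc, List.singleton_append]; exact hv
        cases c
        · exact Or.inr ((hK x _).2 ⟨v', hv''⟩)
        · exact Or.inl ((hK x _).2 ⟨v', hv''⟩)
  /- Step 4: the decision procedure `x ↦ RE x (final branch)`. -/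
  obtain ⟨Dec, hDec⟩ : ∃ Dec : List Bool → Bool, Dec = fun x =>
      RE x ((List.range (m x)).foldl (fun z _ => stepK x z) []) := ⟨_, rfl⟩
  have hDec1 : ∀ x ∈ L, Dec x = true := by
    intro x hx
    obtain ⟨hmem, hlen⟩ := hinv x hx (m x) le_rfl
    obtain ⟨v, hv⟩ := (hK x _).1 hmem
    have hl := hRElen x _ hv
    rw [List.length_append, hlen, ← hmx] at hl
    have hv0 : v = [] := List.eq_nil_of_length_eq_zero (by omega)
    rw [hv0, List.append_nil] at hv
    rw [hDec]
    exact hv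
  have hDec2 : ∀ x, Dec x = true → x ∈ L := by
    intro x hx
    rw [hDec] at hx
    exact hRE1 _ _ hx
  have hDecC : CodeFP strE bitE Dec := by
    have hmC : CodeFP strE unE m := by
      rw [hm]; exact (unSucc.comp ((hpolyU p).comp strLength) :)
    have hcT : CodeFP (pairE strE (pairE natE strE)) strE (fun _ => [true]) := CodeFP.const _ [true]
    have hcF : CodeFP (pairE strE (pairE natE strE)) strE (fun _ => [false]) :=
      CodeFP.const _ [false]
    have hza : CodeFP (pairE strE (pairE natE strE)) strE (fun t => t.2.2 ++ [true]) :=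
      (strAppend.comp ((CodeFP.snd _ _).snd'.pair hcT) :)
    have hzb : CodeFP (pairE strE (pairE natE strE)) strE (fun t => t.2.2 ++ [false]) :=
      (strAppend.comp ((CodeFP.snd _ _).snd'.pair hcF) :)
    have hpa : CodeFP (pairE strE (pairE natE strE)) strE
        (fun t => boolPair t.1 (t.2.2 ++ [true])) :=
      ((CodeFP.fst _ _).pair hza).recodeOut fun _ => rfl
    have hpb : CodeFP (pairE strE (pairE natE strE)) strE
        (fun t => boolPair t.1 (t.2.2 ++ [false])) :=
      ((CodeFP.fst _ _).pair hzb).recodeOut fun _ => rfl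
    have hselC : CodeFP (pairE strE (pairE natE strE)) strE
        (fun t => selK (boolPair t.1 (t.2.2 ++ [true])) (boolPair t.1 (t.2.2 ++ [false]))) :=
      (hselKC.comp (hpa.pair hpb) :)
    have hbit : CodeFP (pairE strE (pairE natE strE)) bitE
        (fun t => decide (selK (boolPair t.1 (t.2.2 ++ [true])) (boolPair t.1 (t.2.2 ++ [false])) =
          boolPair t.1 (t.2.2 ++ [true]))) :=
      ((CodeFP.eq (eα := strE) Function.injective_id).comp (hselC.pair hpa) :)
    have hstepC : CodeFP (pairE strE (pairE natE strE)) strE (fun t => stepK t.1 t.2.2) := by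
      rw [hstepK]
      exact (CodeFP.ite hbit hza hzb :)
    have hnil : CodeFP strE strE (fun _ => ([] : List Bool)) := CodeFP.const _ []
    have hfoldC : CodeFP (pairE strE (rawE natE)) strE
        (fun q => q.2.foldl (fun z _ => stepK q.1 z) []) := by
      refine (CodeFP.foldl (step := fun x (_ : ℕ) z => stepK x z) (init := fun _ => [])
        hstepC hnil X fun x l₁ l₂ => ?_ :)
      rw [eval_X]
      show (l₁.foldl (fun z _ => stepK x z) []).length ≤ _
      rw [hfold_len, List.length_nil, Nat.zero_add, pairE_apply, length_boolPair]
      dsimp only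
      have h₁ := length_le_length_rawE natE (l₁ ++ l₂)
      rw [List.length_append] at h₁
      omega
    have hiterC : CodeFP strE strE
        (fun x => (List.range (m x)).foldl (fun z _ => stepK x z) []) :=
      (hfoldC.comp₂ (CodeFP.id _) (urange.comp hmC) :)
    rw [hDec]
    exact (hREC.comp ((CodeFP.id _).pair hiterC) :)
  obtain ⟨d, hd, hdx⟩ := hDecC
  refine mem_P_of_mem_FP hd _ fun x => ⟨fun hx => ?_, fun hx => ?_⟩
  · have := hdx x
    rw [hDec1 x hx] at this
    exact this
  · have := hdx x
    cases hDx : Dec x with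
    | true => exact absurd (hDec2 x hDx) hx
    | false => rw [hDx] at this; exact this

/-- The singleton language `{ε}` is in `P`. [folklore] -/
theorem singleton_nil_mem_P : ({u | u = []} : Language Bool) ∈ Classes.P := by
  classical
  have hnil : CodeFP strE strE (fun _ => ([] : List Bool)) := CodeFP.const _ []
  have htest : CodeFP strE bitE (fun u : List Bool => decide (u = [])) :=
    ((CodeFP.eq (eα := strE) Function.injective_id).comp ((CodeFP.id _).pair hnil) :)
  obtain ⟨d, hd, hdu⟩ := htest
  refine mem_P_of_mem_FP hd _ fun u => ⟨fun hu => ?_, fun hu => ?_⟩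
  · have := hdu u
    beta_reduce at this
    rw [decide_eq_true (show u = [] from hu)] at this
    exact this
  · have := hdu u
    beta_reduce at this
    rw [decide_eq_false (show ¬ u = [] from hu)] at this
    exact this

/-- **An `NP`-hard P-selective set exists iff `NP ⊆ P`** (for `⇐`, the hard set `{ε}` is in `P`,
hence P-selective). [cite: HemaspaandraTorenvliet2003, Thm. 4.1 (held book:hemaspaandra2003-theory-semi-feasible-algorithms chunk p0099)]
[cite: Selman1979, main theorem (theorem number not verified: source not held)] -/
theorem exists_isHard_selector_iff :
    (∃ T : Language Bool, IsHard Nondeterministic.NP T ∧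
      ∃ s ∈ FP, ∀ a b : List Bool, (s (boolPair a b) = a ∨ s (boolPair a b) = b) ∧
        ((a ∈ T ∨ b ∈ T) → s (boolPair a b) ∈ T)) ↔
    Nondeterministic.NP ⊆ Classes.P := by
  constructor
  · rintro ⟨T, hT, hs⟩
    exact NP_subset_P_of_isHard_of_selector hT hs
  · intro h
    exact ⟨_, isHard_singleton_nil_of_NP_subset_P h, exists_selector_of_mem_P singleton_nil_mem_P⟩

end Literature.Computability.Complexity
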